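import Mathlib
import HarnessLib

/-!
# Arithmetic for the degrees of the primitive actions of `S_m` and `A_m`

Topic `Literature/GroupTheory/PermutationGroups`.  Fully PROVED elementary inequalities comparing
`m! = |S_m|` with `50 · n^{⌊√n⌋}` when `n` is bounded below by (half) the index of an
imprimitive or of a primitive maximal subgroup of `S_m` — the "elementary calculations" of
A. Maróti, *On the orders of primitive groups*, J. Algebra 258 (2002), proof of Theorem 1.1,
Step 3 and Lemma 2.1 (author's version pp. 5–7), in the weaker form that suffices for
Corollary 1.1 (ii) (`|G| < 50 · n^{√n}`) rather than for Theorem 1.1 (iii):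

* `two_pow_le_choose_succ_double` — `2^t ≤ C(2t+1, t)`.
* `succ_mul_two_pow_le_choose` — `(b+1) · 2^{a-1} ≤ C(a(b+1), a)` (`a, b ≥ 1`).
* `factorial_pow_mul_factorial_mul_two_pow_le` — **`(a!)^b · b! · 2^{(a-1)(b-1)} ≤ (ab)!`**:
  the wreath product `S_a wr S_b` has index at least `2^{(a-1)(b-1)}` in `S_{ab}`.
* `lt_fifty_mul_pow_sqrt_of_threshold`, `pow_sqrt_le_pow_sqrt` — the monotone threshold engine.
* `factorial_lt_fifty_mul_pow_sqrt_of_le_wreath` — **imprimitive case**: if `a, b ≥ 2` and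
  `(ab)! ≤ 2n · (a!)^b · b!` (i.e. `n` is at least half the index of `S_a wr S_b`), then
  `(ab)! < 50 · n^{⌊√n⌋}` (`ab ≥ 20`: `n ≥ 2^e`, `e = (a-1)(b-1) - 1 ≥ ab/2 - 2`, and
  `(ab)! ≤ 2^{ab([log₂ ab]+1)} ≤ (2^e)^{2^{[e/2]}}`; `ab < 20`: the 23 shapes one by one).
* `factorial_lt_fifty_mul_pow_sqrt_of_factorial_half_le` — **primitive case** (after Bochert):
  if `m, n ≥ 5` and `((m+1)/2)! ≤ 2n`, then `m! < 50 · n^{⌊√n⌋}`.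
-/

namespace Literature.GroupTheory.PermutationGroups

section Engine

/-- `N ↦ N^{⌊√N⌋}` is monotone on `N ≥ 1`. [folklore] -/
theorem pow_sqrt_le_pow_sqrt {a b : ℕ} (ha : 1 ≤ a) (hab : a ≤ b) :
    a ^ Nat.sqrt a ≤ b ^ Nat.sqrt b :=
  (Nat.pow_le_pow_left hab _).trans (Nat.pow_le_pow_right (by omega) (Nat.sqrt_le_sqrt hab))

/-- **Threshold engine.** If `M < 50 · B^{⌊√B⌋}`, `2 (B-1) X < M` and `M ≤ 2 n X`, then `n ≥ B`
and so `M < 50 · n^{⌊√n⌋}`. [folklore] -/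
theorem lt_fifty_mul_pow_sqrt_of_threshold {M X n B : ℕ} (hB : M < 50 * B ^ Nat.sqrt B)
    (hlt : 2 * (B - 1) * X < M) (hB1 : 1 ≤ B) (h : M ≤ 2 * n * X) :
    M < 50 * n ^ Nat.sqrt n := by
  have hBn : B ≤ n := by
    by_contra hlt'
    push Not at hlt'
    have : 2 * n * X ≤ 2 * (B - 1) * X :=
      Nat.mul_le_mul_right _ (Nat.mul_le_mul_left _ (by omega))
    omega
  calc M < 50 * B ^ Nat.sqrt B := hB
    _ ≤ 50 * n ^ Nat.sqrt n := Nat.mul_le_mul_left 50 (pow_sqrt_le_pow_sqrt hB1 hBn)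

end Engine

section Wreath

/-- `2^t ≤ C(2t+1, t)` (Pascal twice and the symmetry `C(2t+1, t+1) = C(2t+1, t)`). [folklore] -/
theorem two_pow_le_choose_succ_double (t : ℕ) : 2 ^ t ≤ (2 * t + 1).choose t := by
  induction t with
  | zero => simp
  | succ t ih =>
    have h1 : (2 * (t + 1) + 1).choose (t + 1) =
        (2 * t + 2).choose t + (2 * t + 2).choose (t + 1) := by
      rw [show 2 * (t + 1) + 1 = (2 * t + 2) + 1 by ring, Nat.choose_succ_succ]
    have h2 : (2 * t + 2).choose (t + 1) = (2 * t + 1).choose t + (2 * t + 1).choose (t + 1) := by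
      rw [show 2 * t + 2 = (2 * t + 1) + 1 by ring, Nat.choose_succ_succ]
    have h3 : (2 * t + 1).choose (t + 1) = (2 * t + 1).choose t := Nat.choose_symm_half t
    calc 2 ^ (t + 1) = 2 ^ t + 2 ^ t := by ring
      _ ≤ (2 * t + 1).choose t + (2 * t + 1).choose t := Nat.add_le_add ih ih
      _ = (2 * t + 2).choose (t + 1) := by rw [h2, h3]
      _ ≤ (2 * (t + 1) + 1).choose (t + 1) := by rw [h1]; exact Nat.le_add_left _ _

/-- `(b+1) · 2^{a-1} ≤ C(a(b+1), a)` for `a, b ≥ 1`: indeed `C(a(b+1), a) = (b+1) · C(a(b+1)-1, a-1)`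
and `C(a(b+1)-1, a-1) ≥ C(2a-1, a-1) ≥ 2^{a-1}`. [folklore] -/
theorem succ_mul_two_pow_le_choose {a b : ℕ} (ha : 1 ≤ a) (hb : 1 ≤ b) :
    (b + 1) * 2 ^ (a - 1) ≤ (a * (b + 1)).choose a := by
  obtain ⟨t, rfl⟩ : ∃ t, a = t + 1 := ⟨a - 1, by omega⟩
  rw [Nat.add_sub_cancel]
  have hpos : 1 ≤ (t + 1) * (b + 1) := Nat.one_le_iff_ne_zero.mpr (by positivity)
  have key := Nat.add_one_mul_choose_eq ((t + 1) * (b + 1) - 1) t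
  rw [Nat.sub_add_cancel hpos] at key
  -- key : (t+1)(b+1) * C((t+1)(b+1)-1, t) = C((t+1)(b+1), t+1) * (t+1)
  have key' : (b + 1) * ((t + 1) * (b + 1) - 1).choose t = ((t + 1) * (b + 1)).choose (t + 1) := by
    apply Nat.eq_of_mul_eq_mul_left (show 0 < t + 1 by omega)
    calc (t + 1) * ((b + 1) * ((t + 1) * (b + 1) - 1).choose t)
        = (t + 1) * (b + 1) * ((t + 1) * (b + 1) - 1).choose t := by ring
      _ = ((t + 1) * (b + 1)).choose (t + 1) * (t + 1) := key
      _ = (t + 1) * ((t + 1) * (b + 1)).choose (t + 1) := by ring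
  have hmono : (2 * t + 1).choose t ≤ ((t + 1) * (b + 1) - 1).choose t := by
    apply Nat.choose_le_choose
    have : 2 * t + 2 ≤ (t + 1) * (b + 1) := by nlinarith
    omega
  calc (b + 1) * 2 ^ t ≤ (b + 1) * ((t + 1) * (b + 1) - 1).choose t :=
        Nat.mul_le_mul_left _ ((two_pow_le_choose_succ_double t).trans hmono)
    _ = ((t + 1) * (b + 1)).choose (t + 1) := key'

/-- **The index of `S_a wr S_b` in `S_{ab}` is at least `2^{(a-1)(b-1)}`**:
`(a!)^b · b! · 2^{(a-1)(b-1)} ≤ (ab)!` for `a, b ≥ 1` (induction on `b`, peeling off one block: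
`(ab + a)! = (ab)! · a! · C(ab+a, a)` and `C(ab+a, a) ≥ (b+1) · 2^{a-1}`). [folklore] -/
theorem factorial_pow_mul_factorial_mul_two_pow_le {a : ℕ} (ha : 1 ≤ a) {b : ℕ} (hb : 1 ≤ b) :
    a.factorial ^ b * b.factorial * 2 ^ ((a - 1) * (b - 1)) ≤ (a * b).factorial := by
  induction b, hb using Nat.le_induction with
  | base => simp
  | succ b hb ih =>
    have hexp : (a - 1) * (b + 1 - 1) = (a - 1) * (b - 1) + (a - 1) := by
      rw [Nat.add_sub_cancel]
      conv_lhs => rw [show b = (b - 1) + 1 by omega]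
      ring
    have hfac : (a * (b + 1)).choose a * (a * b).factorial * a.factorial =
        (a * (b + 1)).factorial := by
      have := Nat.add_choose_mul_factorial_mul_factorial (a * b) a
      rwa [show a * b + a = a * (b + 1) by ring] at this
    calc a.factorial ^ (b + 1) * (b + 1).factorial * 2 ^ ((a - 1) * (b + 1 - 1))
        = (a.factorial ^ b * b.factorial * 2 ^ ((a - 1) * (b - 1))) *
            (a.factorial * ((b + 1) * 2 ^ (a - 1))) := by
          rw [hexp, pow_succ, pow_add, Nat.factorial_succ]
          ring
      _ ≤ (a * b).factorial * (a.factorial * (a * (b + 1)).choose a) :=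
          Nat.mul_le_mul ih (Nat.mul_le_mul_left _ (succ_mul_two_pow_le_choose ha hb))
      _ = (a * (b + 1)).factorial := by rw [← hfac]; ring

/-- `(2k+1)² ≤ 2^k` for `k ≥ 9`. [folklore] -/
theorem sq_succ_double_le_two_pow {k : ℕ} (hk : 9 ≤ k) : (2 * k + 1) * (2 * k + 1) ≤ 2 ^ k := by
  induction k, hk using Nat.le_induction with
  | base => norm_num
  | succ k hk ih =>
    have h8 : 8 * k + 8 ≤ 2 ^ k := by nlinarith
    calc (2 * (k + 1) + 1) * (2 * (k + 1) + 1) = (2 * k + 1) * (2 * k + 1) + (8 * k + 8) := by ring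
      _ ≤ 2 ^ k + 2 ^ k := Nat.add_le_add ih h8
      _ = 2 ^ (k + 1) := by ring

/-- For `e ≥ 8`: `(2e+4) · ([log₂ (2e+4)] + 1) ≤ e · 2^{[e/2]}` (`e ≤ 17` by inspection; beyond,
`[log₂ x] + 1 ≤ x` and `(2e+4)² ≤ e³ ≤ e · 2^{[e/2]}`). [folklore] -/
theorem helper_log_two_pow {e : ℕ} (he : 8 ≤ e) :
    (2 * e + 4) * (Nat.log 2 (2 * e + 4) + 1) ≤ e * 2 ^ (e / 2) := by
  rcases Nat.lt_or_ge e 18 with h | h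
  · interval_cases e <;> norm_num
  · have hlog : Nat.log 2 (2 * e + 4) + 1 ≤ 2 * e + 4 :=
      Nat.succ_le_of_lt (Nat.log_lt_self 2 (by omega))
    have hsq : (2 * e + 4) * (2 * e + 4) ≤ e * (e * e) := by nlinarith
    have hpow : e * e ≤ 2 ^ (e / 2) := by
      have h9 : 9 ≤ e / 2 := by omega
      have he2 : e ≤ 2 * (e / 2) + 1 := by omega
      calc e * e ≤ (2 * (e / 2) + 1) * (2 * (e / 2) + 1) := Nat.mul_le_mul he2 he2
        _ ≤ 2 ^ (e / 2) := sq_succ_double_le_two_pow h9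
    calc (2 * e + 4) * (Nat.log 2 (2 * e + 4) + 1) ≤ (2 * e + 4) * (2 * e + 4) :=
          Nat.mul_le_mul_left _ hlog
      _ ≤ e * (e * e) := hsq
      _ ≤ e * 2 ^ (e / 2) := Nat.mul_le_mul_left _ hpow

/-- **Imprimitive case.** If `a, b ≥ 2` and `(ab)! ≤ 2 n · (a!)^b · b!` — i.e. `n` is at least
half the index `(ab)!/((a!)^b b!)` of the wreath product `S_a wr S_b` in `S_{ab}` — then
`(ab)! < 50 · n^{⌊√n⌋}`.  (Maróti's Lemma 2.1 proves the sharper `m! ≤` bound (iii) at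
`n = m!/((b!)^a a!)` for `m ≥ 8`.) [cite: Maroti2002, Lemma 2.1 and proof of Theorem 1.1, Step 3] -/
theorem factorial_lt_fifty_mul_pow_sqrt_of_le_wreath {a b n : ℕ} (ha : 2 ≤ a) (hb : 2 ≤ b)
    (h : (a * b).factorial ≤ 2 * n * (a.factorial ^ b * b.factorial)) :
    (a * b).factorial < 50 * n ^ Nat.sqrt n := by
  rcases Nat.lt_or_ge (a * b) 20 with hm | hm
  · -- the 23 shapes with `ab < 20`, by the threshold engine
    have ha9 : a ≤ 9 := by nlinarith
    have hb9 : b ≤ 9 := by nlinarith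
    interval_cases a
    · interval_cases b
      · exact lt_fifty_mul_pow_sqrt_of_threshold (B := 1) (by norm_num [Nat.factorial])
          (by norm_num [Nat.factorial]) (by norm_num) h
      · exact lt_fifty_mul_pow_sqrt_of_threshold (B := 4) (by norm_num [Nat.factorial])
          (by norm_num [Nat.factorial]) (by norm_num) h
      · exact lt_fifty_mul_pow_sqrt_of_threshold (B := 10) (by norm_num [Nat.factorial])
          (by norm_num [Nat.factorial]) (by norm_num) h
      · exact lt_fifty_mul_pow_sqrt_of_threshold (B := 17) (by norm_num [Nat.factorial])
          (by norm_num [Nat.factorial]) (by norm_num) h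
      · exact lt_fifty_mul_pow_sqrt_of_threshold (B := 25) (by norm_num [Nat.factorial])
          (by norm_num [Nat.factorial]) (by norm_num) h
      · exact lt_fifty_mul_pow_sqrt_of_threshold (B := 36) (by norm_num [Nat.factorial])
          (by norm_num [Nat.factorial]) (by norm_num) h
      · exact lt_fifty_mul_pow_sqrt_of_threshold (B := 49) (by norm_num [Nat.factorial])
          (by norm_num [Nat.factorial]) (by norm_num) h
      · exact lt_fifty_mul_pow_sqrt_of_threshold (B := 64) (by norm_num [Nat.factorial])
          (by norm_num [Nat.factorial]) (by norm_num) h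
    · interval_cases b
      · exact lt_fifty_mul_pow_sqrt_of_threshold (B := 4) (by norm_num [Nat.factorial])
          (by norm_num [Nat.factorial]) (by norm_num) h
      · exact lt_fifty_mul_pow_sqrt_of_threshold (B := 16) (by norm_num [Nat.factorial])
          (by norm_num [Nat.factorial]) (by norm_num) h
      · exact lt_fifty_mul_pow_sqrt_of_threshold (B := 25) (by norm_num [Nat.factorial])
          (by norm_num [Nat.factorial]) (by norm_num) h
      · exact lt_fifty_mul_pow_sqrt_of_threshold (B := 49) (by norm_num [Nat.factorial])
          (by norm_num [Nat.factorial]) (by norm_num) h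
      · exact lt_fifty_mul_pow_sqrt_of_threshold (B := 64) (by norm_num [Nat.factorial])
          (by norm_num [Nat.factorial]) (by norm_num) h
      · omega
      · omega
      · omega
    · interval_cases b
      · exact lt_fifty_mul_pow_sqrt_of_threshold (B := 10) (by norm_num [Nat.factorial])
          (by norm_num [Nat.factorial]) (by norm_num) h
      · exact lt_fifty_mul_pow_sqrt_of_threshold (B := 25) (by norm_num [Nat.factorial])
          (by norm_num [Nat.factorial]) (by norm_num) h
      · exact lt_fifty_mul_pow_sqrt_of_threshold (B := 49) (by norm_num [Nat.factorial])
          (by norm_num [Nat.factorial]) (by norm_num) h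
      · omega
      · omega
      · omega
      · omega
      · omega
    · interval_cases b
      · exact lt_fifty_mul_pow_sqrt_of_threshold (B := 17) (by norm_num [Nat.factorial])
          (by norm_num [Nat.factorial]) (by norm_num) h
      · exact lt_fifty_mul_pow_sqrt_of_threshold (B := 49) (by norm_num [Nat.factorial])
          (by norm_num [Nat.factorial]) (by norm_num) h
      · omega
      · omega
      · omega
      · omega
      · omega
      · omega
    · interval_cases b
      · exact lt_fifty_mul_pow_sqrt_of_threshold (B := 25) (by norm_num [Nat.factorial])
          (by norm_num [Nat.factorial]) (by norm_num) h
      · exact lt_fifty_mul_pow_sqrt_of_threshold (B := 64) (by norm_num [Nat.factorial])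
          (by norm_num [Nat.factorial]) (by norm_num) h
      · omega
      · omega
      · omega
      · omega
      · omega
      · omega
    · interval_cases b
      · exact lt_fifty_mul_pow_sqrt_of_threshold (B := 36) (by norm_num [Nat.factorial])
          (by norm_num [Nat.factorial]) (by norm_num) h
      · omega
      · omega
      · omega
      · omega
      · omega
      · omega
      · omega
    · interval_cases b
      · exact lt_fifty_mul_pow_sqrt_of_threshold (B := 49) (by norm_num [Nat.factorial])
          (by norm_num [Nat.factorial]) (by norm_num) h
      · omega
      · omega
      · omega
      · omega
      · omega
      · omega
      · omega
    · interval_cases b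
      · exact lt_fifty_mul_pow_sqrt_of_threshold (B := 64) (by norm_num [Nat.factorial])
          (by norm_num [Nat.factorial]) (by norm_num) h
      · omega
      · omega
      · omega
      · omega
      · omega
      · omega
      · omega
  · -- `ab ≥ 20`
    have hX : 0 < a.factorial ^ b * b.factorial := by positivity
    have h2 := factorial_pow_mul_factorial_mul_two_pow_le (a := a) (by omega) (b := b) (by omega)
    have h3 : 2 ^ ((a - 1) * (b - 1)) ≤ 2 * n := by
      have : a.factorial ^ b * b.factorial * 2 ^ ((a - 1) * (b - 1)) ≤
          a.factorial ^ b * b.factorial * (2 * n) := by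
        calc _ ≤ (a * b).factorial := h2
          _ ≤ 2 * n * (a.factorial ^ b * b.factorial) := h
          _ = a.factorial ^ b * b.factorial * (2 * n) := by ring
      exact Nat.le_of_mul_le_mul_left this hX
    obtain ⟨a', rfl⟩ : ∃ a', a = a' + 2 := ⟨a - 2, by omega⟩
    obtain ⟨b', rfl⟩ : ∃ b', b = b' + 2 := ⟨b - 2, by omega⟩
    rw [show a' + 2 - 1 = a' + 1 by omega, show b' + 2 - 1 = b' + 1 by omega] at h3
    obtain ⟨e, he⟩ : ∃ e, (a' + 1) * (b' + 1) = e + 1 :=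
      ⟨(a' + 1) * (b' + 1) - 1, by
        have : 1 ≤ (a' + 1) * (b' + 1) := Nat.one_le_iff_ne_zero.mpr (by positivity)
        omega⟩
    have hem : (a' + 2) * (b' + 2) ≤ 2 * e + 4 := by nlinarith
    have he8 : 8 ≤ e := by omega
    have hn : 2 ^ e ≤ n := by
      rw [he, pow_succ] at h3
      omega
    set m := (a' + 2) * (b' + 2) with hm'
    have hlogm : m < 2 ^ (Nat.log 2 m + 1) := Nat.lt_pow_succ_log_self (by norm_num) m
    have hmL : m * (Nat.log 2 m + 1) ≤ e * 2 ^ (e / 2) :=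
      calc m * (Nat.log 2 m + 1) ≤ (2 * e + 4) * (Nat.log 2 (2 * e + 4) + 1) :=
            Nat.mul_le_mul hem (Nat.add_le_add_right (Nat.log_mono_right hem) 1)
        _ ≤ e * 2 ^ (e / 2) := helper_log_two_pow he8
    have hsqrt : 2 ^ (e / 2) ≤ Nat.sqrt (2 ^ e) := by
      rw [Nat.le_sqrt', ← pow_mul]
      exact Nat.pow_le_pow_right (by norm_num) (by omega)
    have h1e : 1 ≤ 2 ^ e := Nat.one_le_two_pow
    calc m.factorial ≤ m ^ m := Nat.factorial_le_pow m
      _ ≤ (2 ^ (Nat.log 2 m + 1)) ^ m := Nat.pow_le_pow_left hlogm.le m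
      _ = 2 ^ (m * (Nat.log 2 m + 1)) := by rw [← pow_mul, mul_comm]
      _ ≤ 2 ^ (e * 2 ^ (e / 2)) := Nat.pow_le_pow_right (by norm_num) hmL
      _ = (2 ^ e) ^ (2 ^ (e / 2)) := by rw [pow_mul]
      _ ≤ (2 ^ e) ^ Nat.sqrt (2 ^ e) := Nat.pow_le_pow_right h1e hsqrt
      _ ≤ n ^ Nat.sqrt n := pow_sqrt_le_pow_sqrt h1e hn
      _ < 50 * n ^ Nat.sqrt n := by
          have : 0 < n ^ Nat.sqrt n := Nat.pow_pos (by omega)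
          omega

end Wreath

section Primitive

/-- `8 k² ≤ k!` for `k ≥ 6`. [folklore] -/
theorem eight_mul_sq_le_factorial {k : ℕ} (hk : 6 ≤ k) : 8 * (k * k) ≤ k.factorial := by
  induction k, hk using Nat.le_induction with
  | base => norm_num [Nat.factorial]
  | succ k hk ih =>
    have h1 : 8 * (k + 1) ≤ k.factorial := by nlinarith
    calc 8 * ((k + 1) * (k + 1)) = (k + 1) * (8 * (k + 1)) := by ring
      _ ≤ (k + 1) * k.factorial := Nat.mul_le_mul_left _ h1
      _ = (k + 1).factorial := (Nat.factorial_succ k).symm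

/-- **Primitive case** (to be combined with Bochert's bound `[S_m : H] ≥ ((m+1)/2)!` for a
primitive `H < S_m` not containing `A_m`): if `m, n ≥ 5` and `((m+1)/2)! ≤ 2n`, then
`m! < 50 · n^{⌊√n⌋}`.  For `m ≥ 11` (`h = (m+1)/2 ≥ 6`): `n ≥ h!/2 ≥ 4h²`, so
`m! ≤ (2h)! ≤ (2h)^{2h} ≤ n^{2h} ≤ n^{⌊√n⌋}`; `5 ≤ m ≤ 10` by inspection ("if it is primitive,
then `|G| ≤ n⁴ ≤ n^{[log₂ n]}` if `n ≥ 16`, by Bochert's lemma, else `n = 15` and `G ≅ A₇`").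
[cite: Maroti2002, proof of Theorem 1.1, Step 3] -/
theorem factorial_lt_fifty_mul_pow_sqrt_of_factorial_half_le {m n : ℕ} (hm : 5 ≤ m) (hn : 5 ≤ n)
    (h : ((m + 1) / 2).factorial ≤ 2 * n) : m.factorial < 50 * n ^ Nat.sqrt n := by
  rcases Nat.lt_or_ge m 11 with hm11 | hm11
  · interval_cases m <;> norm_num [Nat.factorial] at h ⊢
    · -- m = 5, B = 3
      calc (120 : ℕ) < 50 * 3 ^ Nat.sqrt 3 := by norm_num
        _ ≤ 50 * n ^ Nat.sqrt n := Nat.mul_le_mul_left 50 (pow_sqrt_le_pow_sqrt (by norm_num) (by omega))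
    · -- m = 6, B = 4
      calc (720 : ℕ) < 50 * 4 ^ Nat.sqrt 4 := by norm_num
        _ ≤ 50 * n ^ Nat.sqrt n := Nat.mul_le_mul_left 50 (pow_sqrt_le_pow_sqrt (by norm_num) (by omega))
    · -- m = 7, B = 9
      calc (5040 : ℕ) < 50 * 9 ^ Nat.sqrt 9 := by norm_num
        _ ≤ 50 * n ^ Nat.sqrt n := Nat.mul_le_mul_left 50 (pow_sqrt_le_pow_sqrt (by norm_num) (by omega))
    · -- m = 8, B = 10
      calc (40320 : ℕ) < 50 * 10 ^ Nat.sqrt 10 := by norm_num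
        _ ≤ 50 * n ^ Nat.sqrt n := Nat.mul_le_mul_left 50 (pow_sqrt_le_pow_sqrt (by norm_num) (by omega))
    · -- m = 9, B = 16
      calc (362880 : ℕ) < 50 * 16 ^ Nat.sqrt 16 := by norm_num
        _ ≤ 50 * n ^ Nat.sqrt n := Nat.mul_le_mul_left 50 (pow_sqrt_le_pow_sqrt (by norm_num) (by omega))
    · -- m = 10, B = 17
      calc (3628800 : ℕ) < 50 * 17 ^ Nat.sqrt 17 := by norm_num
        _ ≤ 50 * n ^ Nat.sqrt n := Nat.mul_le_mul_left 50 (pow_sqrt_le_pow_sqrt (by norm_num) (by omega))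
  · set h' := (m + 1) / 2 with hh
    have h6 : 6 ≤ h' := by omega
    have hm2 : m ≤ 2 * h' := by omega
    have hfac8 := eight_mul_sq_le_factorial h6
    have hn4 : 4 * (h' * h') ≤ n := by omega
    have hs : 2 * h' ≤ Nat.sqrt n := by
      rw [Nat.le_sqrt']
      nlinarith
    have hn2 : 2 * h' ≤ n := le_trans (by nlinarith) hn4
    have hn1 : 1 ≤ n := by omega
    calc m.factorial ≤ (2 * h').factorial := Nat.factorial_le hm2
      _ ≤ (2 * h') ^ (2 * h') := Nat.factorial_le_pow _
      _ ≤ n ^ (2 * h') := Nat.pow_le_pow_left hn2 _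
      _ ≤ n ^ Nat.sqrt n := Nat.pow_le_pow_right hn1 hs
      _ < 50 * n ^ Nat.sqrt n := by
          have : 0 < n ^ Nat.sqrt n := Nat.pow_pos (by omega)
          omega

end Primitive

end Literature.GroupTheory.PermutationGroups
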